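import Literature.Analysis.FluidPDE.HardSphereFlowRestart
import HarnessLib

/-!
# Collision instants of Alexander's construction: real partial sums and counted collisions

Crux `Summit.AtomisticToContinuum.HydrodynamicLimit.Theses.LambertianContactSwap.ContactAngleEquidistribution`
(stmt-AtomisticToContinuum-12097), line `Sketch` v7, stub group `boostInstants` (registered stubs
`exitSum_eq_toReal_collisionInstant`, `collisionInstant_succ_le_of_mem_range`). Line v7 extends the proved
equilibrium case of the crux to drifting Gibbs laws by Galilean covariance of Alexander's collision-by-collision
construction (`HardSphereFlowConstruction`); the crux functional sums a mark over the counted collisions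
`m ∈ Finset.range (collisionCount z t)`, and the covariance bookkeeping needs two elementary facts about the
collision instants `t_k = ∑_{m<k} τ(z_m) ∈ [0, ∞]`, valid with NO goodness assumption on the datum:
(1) a finite instant `t_k < ∞` is, as a real number, the real sum of the (then finite) exit times `τ(z_m)`,
`m < k`; (2) every counted collision happens at an instant `≤ t`: `t_{m+1} ≤ t` for `m < collisionCount z t`
(for a Zeno orbit the count is Mathlib's junk value `sSup = 0` of an unbounded set of naturals, so the range is
empty). References: folklore (Galilean invariance of hard-sphere dynamics; CIP 1994 §4.2, GST 2013 §1.1).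
-/

noncomputable section

open MeasureTheory Set Filter Function
open scoped ENNReal
open Literature.Analysis Literature.Analysis.FluidPDE Literature.MathematicalPhysics.KineticTheory

namespace Summit.AtomisticToContinuum.HydrodynamicLimit.Theorems.ContactAngleEquidistributionSketch

variable {d : Type*} [Fintype d] {n : ℕ}

/-- **A finite collision instant is the real sum of the exit times**: if `t_k < ∞` then every exit time
`τ(z_m)`, `m < k`, is finite (`Alexander.collisionInstant_ne_top_iff`), so `toReal` commutes with the finite sum
(`ENNReal.toReal_sum`). [folklore] -/
theorem exitSum_eq_toReal_collisionInstant (ε : ℝ) {z : Config n d (UnitAddTorus d)} {k : ℕ}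
    (h : Alexander.collisionInstant (Torus.geometry d) ε z k ≠ ∞) :
    ∑ m ∈ Finset.range k,
        (Alexander.freeExitTime (Torus.geometry d) ε (Alexander.stateAfter (Torus.geometry d) ε z m)).toReal =
      (Alexander.collisionInstant (Torus.geometry d) ε z k).toReal := by
  rw [Alexander.collisionInstant, ENNReal.toReal_sum]
  exact fun m hm => Alexander.collisionInstant_ne_top_iff.1 h m (Finset.mem_range.1 hm)

/-- **Every counted collision happens at an instant `≤ t`**: for `m < collisionCount z t` one has
`t_{m+1} ≤ t`. Indeed `collisionCount z t = sSup S`, `S = {k | t_k ≤ t} ∋ 0`; if `S` is bounded above then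
`sSup S ∈ S` (`Nat.sSup_mem`) and `t_{m+1} ≤ t_{sSup S} ≤ t` by monotonicity of the instants; if not, `sSup S`
is the junk value `0` (`Nat.sSup_of_not_bddAbove`) and again `t_0 = 0 ≤ t⁺`, the range being empty anyway. No
goodness assumption on `z` is needed. [folklore] -/
theorem collisionInstant_succ_le_of_mem_range (ε : ℝ) {z : Config n d (UnitAddTorus d)} {t : ℝ} {m : ℕ}
    (hm : m ∈ Finset.range (Alexander.collisionCount (Torus.geometry d) ε z t)) :
    Alexander.collisionInstant (Torus.geometry d) ε z (m + 1) ≤ ENNReal.ofReal t := by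
  have hlast : Alexander.collisionInstant (Torus.geometry d) ε z
      (Alexander.collisionCount (Torus.geometry d) ε z t) ≤ ENNReal.ofReal t := by
    by_cases hb :
        BddAbove {k : ℕ | Alexander.collisionInstant (Torus.geometry d) ε z k ≤ ENNReal.ofReal t}
    · exact Nat.sSup_mem ⟨0, by simp⟩ hb
    · rw [Alexander.collisionCount, Nat.sSup_of_not_bddAbove hb]
      simp
  exact (Alexander.monotone_collisionInstant z (Nat.succ_le_of_lt (Finset.mem_range.1 hm))).trans hlast

end Summit.AtomisticToContinuum.HydrodynamicLimit.Theorems.ContactAngleEquidistributionSketch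

end
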